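import Literature.Analysis.FluidPDE.LerayHopfUniformEnergy

/-!
# Finite-mode condensation, stub FM-SUP: a sup-in-time energy bound on a block

Stub `stub_fmSupEnergy` of the finite-mode condensation corollary of the regular-condensate
theorem (crux `TwohalfdNeg`, line `log-kantorovich-enstrophy-transfer`). For a global
Leray–Hopf solution `v` of the planar Navier–Stokes equations on `T²` with viscosity `κ > 0`
and a smooth steady force `g` (`Torus.IsGlobalLerayHopf κ (fun _ => g) v₀ v`) that satisfies the
energy inequality FROM the time `a > 0`,

  `½‖v(t)‖² + κ ∫ₐᵗ ‖∇v‖₂² ≤ ½‖v(a)‖² + ∫ₐᵗ ∫ ⟪g, v⟫`   for every `t ≥ a`,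

the energy is bounded on the whole block `[a, a + S]` by the initial energy, the force and the
time-integrated energy:

  `‖v(t)‖² ≤ Mz + S ‖g‖² + Me`   whenever `‖v(a)‖² ≤ Mz`, `∫_{(a, a+S]} ‖v‖² ≤ Me`.

Proof (folklore energy bookkeeping, cf. Foias–Manley–Rosa–Temam 2001, Ch. II App. A): drop the
nonnegative dissipation, bound the forcing by Young's inequality
`∫ ⟪g, v(τ)⟫ ≤ ½ (‖g‖² + ‖v(τ)‖²)` (`Torus.integral_inner_le_young` with `ν = 1`) and integrate
in `τ ∈ (a, t] ⊆ (a, a + S]` (`setIntegral_mono_set`, the integrand `‖v(τ)‖²` being nonnegative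
and integrable in time, `Torus.IsGlobalLerayHopf.integrableOn_integral_norm_sq`). If the pairing
`τ ↦ ∫ ⟪g, v(τ)⟫` were not integrable on `(a, t]` its Bochner integral would vanish and the bound
would hold trivially, so no integrability lemma for it is needed.

## References

* C. Foias, O. Manley, R. Rosa, R. Temam, *Navier–Stokes Equations and Turbulence*, Cambridge
  Univ. Press (2001), Ch. II App. A (A.38)–(A.42).
* C. Doering, C. Foias, *Energy dissipation in body-forced turbulence*, JFM 467 (2002), §2.
-/

namespace Summit.AnomalousDissipation.AnomalousDissipation.Theorems.TwohalfdNeg.FiniteModeCondensate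

open MeasureTheory Filter Topology
open scoped ENNReal NNReal InnerProductSpace
open Literature.Analysis.FunctionSpaces Literature.Analysis.FluidPDE

set_option linter.dupNamespace false

/-- **FM-SUP `stub_fmSupEnergy` — sup-in-time energy bound on a block.** For a global Leray–Hopf
solution `v` on `T²` with viscosity `κ > 0` and smooth steady force `g` satisfying the energy
inequality from the time `a > 0`, if `∫_{(a, a+S]} ‖v(t)‖² dt ≤ Me` and `‖v(a)‖² ≤ Mz` then
`‖v(t)‖² ≤ Mz + S ‖g‖² + Me` for every `t ∈ [a, a + S]` (drop the dissipation, Young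
`2⟪g, v⟫ ≤ ‖g‖² + ‖v‖²`, integrate in time). [folklore] -/
theorem stub_fmSupEnergy :
    ∀ (κ a S Me Mz : ℝ) (g v₀ : UnitAddTorus (Fin 2) → EuclideanSpace ℝ (Fin 2))
      (v : ℝ → UnitAddTorus (Fin 2) → EuclideanSpace ℝ (Fin 2)),
      0 < κ → 0 < a → 0 < S → Torus.IsSmooth g → Torus.IsGlobalLerayHopf κ (fun _ => g) v₀ v →
      (∀ t, a ≤ t → Torus.kineticEnergy (v t) + κ * (∫⁻ τ in Set.Ioo a t, Torus.eGradNormSq (v τ)).toReal ≤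
        Torus.kineticEnergy (v a) + ∫ τ in a..t, ∫ x, inner ℝ (g x) (v τ x)) →
      ∫ t in Set.Ioc a (a + S), ∫ x, ‖v t x‖ ^ 2 ≤ Me → ∫ x, ‖v a x‖ ^ 2 ≤ Mz →
      ∀ t ∈ Set.Icc a (a + S), ∫ x, ‖v t x‖ ^ 2 ≤ Mz + S * (∫ x, ‖g x‖ ^ 2) + Me := by
  intro κ a S Me Mz g v₀ v hκ ha hS hg hv hE hMe hMz t ht
  have hat : a ≤ t := ht.1
  have hG0 : 0 ≤ ∫ x, ‖g x‖ ^ 2 := integral_nonneg fun x => sq_nonneg _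
  have hy0 : ∀ τ, 0 ≤ ∫ x, ‖v τ x‖ ^ 2 := fun τ => integral_nonneg fun x => sq_nonneg _
  -- `Me ≥ 0`, the time-integrated energy being nonnegative
  have hMe0 : 0 ≤ Me := (setIntegral_nonneg measurableSet_Ioc fun τ _ => hy0 τ).trans hMe
  -- the energy slice is integrable in time on the block and on `(a, t]`
  have hyi : IntegrableOn (fun τ => ∫ x, ‖v τ x‖ ^ 2) (Set.Ioc a (a + S)) :=
    (hv.integrableOn_integral_norm_sq (by linarith : 0 < a + S)).mono_set
      (Set.Ioc_subset_Ioc_left ha.le)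
  have hyit : IntegrableOn (fun τ => ∫ x, ‖v τ x‖ ^ 2) (Set.Ioc a t) :=
    hyi.mono_set (Set.Ioc_subset_Ioc_right ht.2)
  -- `∫_{(a,t]} ‖v‖² ≤ ∫_{(a,a+S]} ‖v‖² ≤ Me`
  have hIy : ∫ τ in Set.Ioc a t, ∫ x, ‖v τ x‖ ^ 2 ≤ Me :=
    (setIntegral_mono_set hyi (ae_of_all _ fun τ => hy0 τ)
      (Set.Ioc_subset_Ioc_right ht.2).eventuallyLE).trans hMe
  -- the forcing term: `∫ₐᵗ ∫ ⟪g, v⟫ ≤ ½ (S ‖g‖² + Me)`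
  have hforce : ∫ τ in a..t, ∫ x, inner ℝ (g x) (v τ x) ≤ 2⁻¹ * (S * (∫ x, ‖g x‖ ^ 2) + Me) := by
    rw [intervalIntegral.integral_of_le hat]
    by_cases hint : IntegrableOn (fun τ => ∫ x, inner ℝ (g x) (v τ x)) (Set.Ioc a t)
    · haveI : IsFiniteMeasure (volume.restrict (Set.Ioc a t)) :=
        ⟨by rw [Measure.restrict_apply_univ]; exact measure_Ioc_lt_top⟩
      have hAi : Integrable (fun _ : ℝ => (∫ x, ‖g x‖ ^ 2) / (2 * 1))
          (volume.restrict (Set.Ioc a t)) := integrable_const _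
      have hle : ∫ τ in Set.Ioc a t, ∫ x, inner ℝ (g x) (v τ x) ≤
          ∫ τ in Set.Ioc a t, ((∫ x, ‖g x‖ ^ 2) / (2 * 1) + 1 / 2 * ∫ x, ‖v τ x‖ ^ 2) := by
        refine integral_mono_ae hint (hAi.add (hyit.const_mul _)) ?_
        filter_upwards [ae_restrict_mem measurableSet_Ioc] with τ hτ
        exact Torus.integral_inner_le_young one_pos (hg.memLp 2)
          (hv.memLp_two (ha.le.trans hτ.1.le))
      have hrhs : ∫ τ in Set.Ioc a t, ((∫ x, ‖g x‖ ^ 2) / (2 * 1) + 1 / 2 * ∫ x, ‖v τ x‖ ^ 2) =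
          (∫ x, ‖g x‖ ^ 2) / (2 * 1) * (t - a) + 1 / 2 * ∫ τ in Set.Ioc a t, ∫ x, ‖v τ x‖ ^ 2 := by
        rw [integral_add hAi (hyit.const_mul _), integral_const_mul, setIntegral_const,
          Real.volume_real_Ioc_of_le hat, smul_eq_mul, mul_comm]
      rw [hrhs] at hle
      have htS : t - a ≤ S := by linarith [ht.2]
      have h1 : (∫ x, ‖g x‖ ^ 2) / (2 * 1) * (t - a) ≤ 2⁻¹ * (S * ∫ x, ‖g x‖ ^ 2) := by
        rw [mul_one, div_eq_inv_mul, mul_assoc, mul_comm (∫ x, ‖g x‖ ^ 2) (t - a)]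
        exact mul_le_mul_of_nonneg_left (mul_le_mul_of_nonneg_right htS hG0) (by norm_num)
      linarith [hle, hIy, h1]
    · rw [integral_undef hint]
      exact mul_nonneg (by norm_num) (add_nonneg (mul_nonneg hS.le hG0) hMe0)
  -- assemble: drop the dissipation in the energy inequality from `a`
  have hEt := hE t hat
  have hD : 0 ≤ κ * (∫⁻ τ in Set.Ioo a t, Torus.eGradNormSq (v τ)).toReal :=
    mul_nonneg hκ.le ENNReal.toReal_nonneg
  have hkt : Torus.kineticEnergy (v t) = 2⁻¹ * ∫ x, ‖v t x‖ ^ 2 := rfl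
  have hka : Torus.kineticEnergy (v a) = 2⁻¹ * ∫ x, ‖v a x‖ ^ 2 := rfl
  rw [hkt, hka] at hEt
  linarith [hEt, hD, hforce, hMz]

end Summit.AnomalousDissipation.AnomalousDissipation.Theorems.TwohalfdNeg.FiniteModeCondensate
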